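import Mathlib.NumberTheory.NumberField.InfinitePlace.TotallyRealComplex
import Literature.NumberTheory.EllipticCurves.IsogenyNotRationalCMProofs
import Literature.NumberTheory.EllipticCurves.ModPIrreducibleCofinite
import HarnessLib

/-!
# `End_K(E) = ℤ` over a field with a real embedding, and `E[ℓ]` irreducible for almost all `ℓ`
# over totally real fields (Silverman, *Advanced Topics*, Thm. II.2.2(a); *AEC*, Cor. IX.6.3)

Topic `NumberTheory/EllipticCurves`. A *proofs* file (theorems only: nothing is defined, no named
fact is introduced), sibling of `IsogenyNotRationalCMProofs` — which proves
`WeierstrassCurve.not_hasRationalCM_holds : ∀ E/ℚ, End_ℚ(E) = ℤ` — and of `ModPIrreducibleCofinite`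
— which proves Silverman, *AEC*, Cor. IX.6.3 (Serre) over a number field `K` under `End_K(E) = ℤ`
(`WeierstrassCurve.finite_setOf_not_hasIrreducibleModPGaloisRep`). It records the one-line
generalisation of the former from `ℚ` to **any field `K` with a real embedding `K →+* ℝ`** (in
particular every totally real number field, indeed every number field with a real place), and the
resulting unconditional form of the latter over such fields:

* `WeierstrassCurve.not_hasRationalCM_of_ringHom_real` — `End_K(E) = ℤ` (`¬ W.HasRationalCM`,
  `Isogeny.lean`) for every elliptic curve `E = W` over a field `K` admitting `φ : K →+* ℝ`.
  Silverman, *Advanced Topics*, Thm. II.2.2(a) (`[α]_E^σ = [α^σ]_{E^σ}` for `σ ∈ Aut(ℂ)`): with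
  `K ⊂ ℝ ⊂ ℂ` via `φ` and `σ` = complex conjugation (which fixes `K`), an endomorphism `[α]`
  defined over `K` satisfies `[α] = [α]^σ = [ᾱ]`, so `α ∈ R ∩ ℝ = ℤ` (`R` an order in an imaginary
  quadratic field). The proof is the `ℓ`-adic transcription of `not_hasRationalCM_holds` (module
  docstring of `IsogenyNotRationalCMProofs`), verbatim, with the complex conjugation of `Γ_ℚ`
  replaced by a complex conjugation `c ∈ Γ_K` attached to `φ`
  (`Literature.NumberTheory.GaloisRepresentations.exists_isComplexConjugation`): `c² = 1`, `c`
  inverts the roots of unity of `K̄`, hence `det ρ_ℓ(c) = -1`, and an endomorphism defined over `K`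
  commutes with `ρ_ℓ(c)`, forcing the discriminant `t² - 4 deg φ < 0` of a non-scalar
  `φ ∈ End_K(E)` to be a square modulo every odd `ℓ` — impossible at a prime where it is a
  non-residue.
* `WeierstrassCurve.not_hasRationalCM_of_isReal`, `…_of_isTotallyReal` — the same for a number field
  with a real infinite place `w` (embedding `NumberField.InfinitePlace.embedding_of_isReal`), resp. a
  totally real field.
* `WeierstrassCurve.finite_setOf_not_hasIrreducibleModPGaloisRep_of_ringHom_real`,
  `…_of_isTotallyReal`, `WeierstrassCurve.exists_forall_hasIrreducibleModPGaloisRep_of_lt_of_isTotallyReal`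
  — *AEC* Cor. IX.6.3 unconditionally over such fields: the set of primes `ℓ` for which the
  `Γ_K`-module `E[ℓ]` is reducible (`¬ W.HasIrreducibleModPGaloisRep ℓ`, `GaloisAction.lean`) is
  finite; cofinite form. (Uniform in the CM/non-CM dichotomy: a CM curve over a real field has its
  complex multiplication defined only over the CM field, so `End_K(E) = ℤ` still.)

Consumed by `AdmissiblePrimeSupply` (admissible primes of elliptic curves over totally real
fields: `p ≥ 5` unramified, `E[p]` irreducible, good ordinary above `p`).

## References

* [SilvermanAdvancedTopics1994] J. H. Silverman, *Advanced Topics in the Arithmetic of Elliptic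
  Curves*, GTM 151 (1994), Thm. II.2.2(a) (PDF p. 110 of the held copy) and the computation with
  complex conjugation following Remark II.2.2.2 (PDF p. 112).
* [SilvermanAEC2009] J. H. Silverman, *The Arithmetic of Elliptic Curves*, 2nd ed. (2009),
  Cor. IX.6.3 (PDF pp. 252–253), Prop. III.8.1, Prop. III.8.6.

## Design

`noncomputable section`, `open scoped Classical`, one universe `u` (as the siblings). The
Weierstrass-curve statements are deliberate dot-notation extensions of Mathlib's `WeierstrassCurve`
namespace next to `not_hasRationalCM_holds`; the Galois lemma lives in
`Literature.NumberTheory.EllipticCurves`. No definitions, no instances.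
-/

noncomputable section

open scoped Classical

universe u

namespace Literature.NumberTheory.EllipticCurves

/-- **A complex conjugation attached to a real embedding inverts the roots of unity.** For a field
`K` with a real embedding `φ : K →+* ℝ` there is `c ∈ Γ_K = Gal(K̄/K)` with `c² = 1` acting on every
root of unity `t ∈ K̄` by `t ↦ t⁻¹`: take a complex conjugation `c` for `φ`
(`Literature.NumberTheory.GaloisRepresentations.exists_isComplexConjugation`: `ι (c • x) = conj (ι x)`
for an embedding `ι : K̄ → ℂ` over `φ`); roots of unity have absolute value `1`, on which `conj`
is inversion. (The case `K = ℚ` is `exists_absoluteGaloisGroup_rat_smul_eq_inv`.)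
Serre, *Abelian ℓ-adic representations* (1968), I §2.2. [folklore] -/
theorem exists_absoluteGaloisGroup_smul_eq_inv_of_ringHom_real {K : Type u} [Field K]
    (φ : K →+* ℝ) :
    ∃ c : Field.absoluteGaloisGroup K, c * c = 1 ∧
      ∀ (t : AlgebraicClosure K) (N : ℕ), N ≠ 0 → t ^ N = 1 → c • t = t⁻¹ := by
  obtain ⟨c, hc⟩ :=
    Literature.NumberTheory.GaloisRepresentations.exists_isComplexConjugation φ
  refine ⟨c, by rw [← pow_two]; exact hc.sq_eq_one, fun t N hN ht ↦ ?_⟩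
  obtain ⟨ι, -, hι⟩ :=
    Literature.NumberTheory.GaloisRepresentations.isComplexConjugation_iff.mp hc
  apply ι.injective
  rw [hι, map_inv₀]
  have hz : (ι t) ^ N = 1 := by rw [← map_pow, ht, map_one]
  have hnorm : ‖ι t‖ = 1 := by
    have h := congrArg norm hz
    rw [norm_pow, norm_one] at h
    exact (pow_eq_one_iff_of_nonneg (norm_nonneg _) hN).mp h
  rw [Complex.inv_def, Complex.normSq_eq_norm_sq, hnorm]
  simp

end Literature.NumberTheory.EllipticCurves

namespace WeierstrassCurve

open Literature.NumberTheory.EllipticCurves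

variable {K : Type u} [Field K]

/-! ## Silverman, *Advanced Topics*, Thm. II.2.2(a): `End_K(E) = ℤ` when `K` is real -/

/-- **`End_K(E) = ℤ` for an elliptic curve over a field with a real embedding.** If `K` admits a
ring homomorphism `φ : K →+* ℝ` (e.g. `K` a totally real number field, or any number field with a
real place), then no elliptic curve `E = W` over `K` has `K`-rational complex multiplication:
`¬ W.HasRationalCM`. Silverman, *Advanced Topics*, Thm. II.2.2(a) (`[α]_E^σ = [α^σ]_{E^σ}` for all
`σ ∈ Aut(ℂ)`), applied with `σ` the complex conjugation of `ℂ ⊃ ℝ ⊃ φ(K)`, which fixes `K` and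
`E`: an endomorphism `[α]` defined over `K` has `[α] = [α]^σ = [ᾱ]`, so `α` is real, `α ∈ ℤ`. The
proof is the `ℓ`-adic transcription used for `K = ℚ` in `not_hasRationalCM_holds` (see the module
docstring of `IsogenyNotRationalCMProofs`), run with a complex conjugation `c ∈ Γ_K` attached to
`φ` (`exists_absoluteGaloisGroup_smul_eq_inv_of_ringHom_real`): for `φ ∈ End_K(E) ∖ ℤ` the
discriminant `D = t² - 4 deg φ` (`t = 1 + deg φ - deg(1 - φ)`) is negative (`deg(2φ - t) = -D > 0`),
hence a non-residue at some odd prime `ℓ`; but `φ_ℓ` commutes with the reflection `ρ_ℓ(c)`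
(`det ρ_ℓ(c) = -1` by the Weil pairing), so `D` is a square modulo `ℓ`.
[cite: SilvermanAdvancedTopics1994, Thm. II.2.2(a) (with the complex-conjugation computation after Remark II.2.2.2)] -/
theorem not_hasRationalCM_of_ringHom_real (φK : K →+* ℝ) (W : WeierstrassCurve K) [W.IsElliptic] :
    ¬ W.HasRationalCM := by
  intro hCM
  haveI : CharZero K := φK.charZero
  obtain ⟨φ, hφ, hφn⟩ := hCM
  haveI : CharZero (AlgebraicClosure K) :=
    charZero_of_injective_algebraMap (algebraMap K (AlgebraicClosure K)).injective
  -- (0) `φ ≠ 0` and `1 - φ ≠ 0` are isogenies over `K`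
  have hφ0 : φ ≠ 0 := fun h ↦ hφn 0 (by rw [h, Int.cast_zero])
  have hφ1 : (1 - φ : AddMonoid.End W.geomPoints) ≠ 0 := fun h ↦
    hφn 1 (by rw [Int.cast_one]; exact (sub_eq_zero.mp h).symm)
  obtain ⟨φI, hφI⟩ := W.exists_isogeny_of_mem_endRing hφ hφ0
  obtain ⟨φI₁, hφI₁⟩ := W.exists_isogeny_of_mem_endRing (sub_mem (one_mem _) hφ) hφ1
  -- the integers `d = deg φ`, `t = 1 + deg φ - deg(1 - φ)` and `D = t² - 4d`
  set d : ℤ := (φI.deg : ℤ) with hd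
  set t : ℤ := 1 + d - (φI₁.deg : ℤ) with ht
  set D : ℤ := t ^ 2 - 4 * d with hD
  -- (1) for every prime `ℓ`: matrices, with `det R(φ) = d` and `tr R(φ) = t`
  have key : ∀ (ℓ : ℕ) [Fact ℓ.Prime],
      ∃ (R : AddMonoid.End W.geomPoints →+* Matrix (Fin 2) (Fin 2) ℤ_[ℓ])
        (S : Field.absoluteGaloisGroup K →* Matrix (Fin 2) (Fin 2) ℤ_[ℓ]),
        (∀ ψ : Isogeny W W, (R ψ.toAddMonoidHom).det = ψ.deg) ∧
        (∀ σ, (S σ).det =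
          LinearMap.det (W.galoisRepTate ℓ σ : W.tateModule ℓ →ₗ[ℤ_[ℓ]] W.tateModule ℓ)) ∧
        (∀ f ∈ W.equivariantSubring, ∀ σ, R f * S σ = S σ * R f) ∧
        (R φ).det = d ∧ (R φ).trace = t := by
    intro ℓ _
    have hℓ : (ℓ : K) ≠ 0 := Nat.cast_ne_zero.mpr (Fact.out : ℓ.Prime).ne_zero
    obtain ⟨R, S, hR, hS, hRS⟩ := W.exists_tateMatrixRep ℓ hℓ
    have hdet : (R φ).det = d := by
      rw [hd, Int.cast_natCast, ← hφI, hR]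
    have hdet₁ : (1 - R φ).det = ((φI₁.deg : ℤ) : ℤ_[ℓ]) := by
      rw [Int.cast_natCast, ← map_one R, ← map_sub, ← hφI₁, hR]
    refine ⟨R, S, hR, hS, hRS, hdet, ?_⟩
    rw [Matrix.trace_fin_two_eq_one_add_det_sub_det (R φ), hdet, hdet₁, ht]
    push_cast
    ring
  -- (2) `D < 0`: `ψ = 2φ - t` is a non-zero endomorphism of degree `-D`
  have hDneg : D < 0 := by
    set ψ : AddMonoid.End W.geomPoints := φ + φ - (t : AddMonoid.End W.geomPoints) with hψ
    have hψmem : ψ ∈ W.endRing := sub_mem (add_mem hφ hφ) (intCast_mem _ t)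
    have hψ0 : ψ ≠ 0 := by
      intro h0
      have hall : ∀ P : W.geomPoints, φ P + φ P = t • P := fun P ↦ by
        have h := congrArg (fun g : AddMonoid.End W.geomPoints ↦ g P) h0
        change φ P + φ P - (t : AddMonoid.End W.geomPoints) P = 0 at h
        rwa [AddMonoid.End.intCast_apply, sub_eq_zero] at h
      obtain ⟨P, hP2, hP0⟩ := W.exists_two_torsion_ne_zero (Nat.cast_ne_zero.mpr two_ne_zero)
      rcases Int.even_or_odd t with ⟨s, hs⟩ | ⟨s, hs⟩
      · -- `t = 2s`: `2 (φ - s) = 0`, so `φ = [s]`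
        refine hφn s (sub_eq_zero.mp (W.eq_zero_of_mem_endRing_of_zsmul_apply_eq_zero
          (sub_mem hφ (intCast_mem _ s)) (two_ne_zero (α := ℤ)) fun Q ↦ ?_))
        change (2 : ℤ) • (φ Q - (s : AddMonoid.End W.geomPoints) Q) = 0
        rw [AddMonoid.End.intCast_apply, smul_sub, two_zsmul, hall Q, hs, add_zsmul, two_zsmul,
          sub_self]
      · -- `t = 2s + 1`: a point `P` of order `2` would satisfy `P = t • P = φ(2P) = O`
        apply hP0
        have h1 : t • P = 0 := by rw [← hall P, ← map_add, ← two_zsmul, hP2, map_zero]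
        rwa [hs, add_zsmul, one_zsmul, mul_comm, mul_zsmul, hP2, zsmul_zero, zero_add] at h1
    obtain ⟨ψI, hψI⟩ := W.exists_isogeny_of_mem_endRing hψmem hψ0
    have hpos : 0 < ψI.deg := Isogeny.deg_pos_holds ψI
    haveI : Fact (Nat.Prime 3) := ⟨Nat.prime_three⟩
    obtain ⟨R, S, hR, -, -, hdet, htr⟩ := key 3
    have h1 : (R ψ).det = ((ψI.deg : ℤ) : ℤ_[3]) := by rw [Int.cast_natCast, ← hψI, hR]
    have h2 : (R ψ).det = ((-D : ℤ) : ℤ_[3]) := by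
      rw [hψ, map_sub, map_add, map_intCast, Matrix.det_add_self_sub_intCast_fin_two, hdet, htr, hD]
      push_cast
      ring
    have h3 : (ψI.deg : ℤ) = -D := Int.cast_injective (h1.symm.trans h2)
    omega
  -- (3) an odd prime `ℓ` at which `D` is a quadratic non-residue
  obtain ⟨ℓ, hℓp, hℓ2, hJ⟩ := exists_prime_jacobiSym_eq_neg_one hDneg
  haveI : Fact ℓ.Prime := ⟨hℓp⟩
  have hns : ¬ IsSquare ((D : ℤ) : ZMod ℓ) := ZMod.nonsquare_iff_jacobiSym_eq_neg_one.mp hJ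
  have h2 : (2 : ZMod ℓ) ≠ 0 := by
    intro h
    have h' : ((2 : ℕ) : ZMod ℓ) = 0 := by exact_mod_cast h
    rw [ZMod.natCast_eq_zero_iff] at h'
    exact hℓ2 ((Nat.prime_dvd_prime_iff_eq hℓp Nat.prime_two).mp h')
  -- (4) complex conjugation for `φK`: `det ρ_ℓ(c) = -1`, `ρ_ℓ(c)² = 1`, commuting with `φ_ℓ`
  obtain ⟨c, hcc, hc⟩ := exists_absoluteGaloisGroup_smul_eq_inv_of_ringHom_real φK
  have hℓK : (ℓ : K) ≠ 0 := Nat.cast_ne_zero.mpr hℓp.ne_zero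
  have hdetc := W.det_galoisRepTate_eq_neg_one_of_smul_eq_inv ℓ hℓK hc
  obtain ⟨R, S, -, hS, hRS, hdet, htr⟩ := key ℓ
  -- (5) reduce modulo `ℓ` and apply the reflection lemma
  set r : ℤ_[ℓ] →+* ZMod ℓ := PadicInt.toZMod with hr
  have hsq := isSquare_trace_sq_sub_four_mul_det h2 (A := r.mapMatrix (R φ))
    (C := r.mapMatrix (S c))
    (by rw [← map_mul, ← map_mul, hcc, map_one, map_one])
    (by rw [← RingHom.map_det, hS, hdetc, map_neg, map_one])
    (by rw [← map_mul, ← map_mul, hRS φ hφ.2 c])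
  have htr' : (r.mapMatrix (R φ)).trace = (t : ZMod ℓ) := by
    rw [RingHom.mapMatrix_apply, ← AddMonoidHom.map_trace, htr, map_intCast]
  have hdet' : (r.mapMatrix (R φ)).det = (d : ZMod ℓ) := by
    rw [← RingHom.map_det, hdet, map_intCast]
  rw [htr', hdet'] at hsq
  apply hns
  rw [hD]
  push_cast
  exact hsq

/-- **`End_K(E) = ℤ` over a field with a real place**: if the infinite place `w` of `K` is
real, no elliptic curve over `K` has `K`-rational complex multiplication
(`not_hasRationalCM_of_ringHom_real` with the real embedding
`NumberField.InfinitePlace.embedding_of_isReal`). Silverman, *Advanced Topics*, Thm. II.2.2(a).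
[cite: SilvermanAdvancedTopics1994, Thm. II.2.2(a)] -/
theorem not_hasRationalCM_of_isReal {w : NumberField.InfinitePlace K} (hw : w.IsReal)
    (W : WeierstrassCurve K) [W.IsElliptic] : ¬ W.HasRationalCM :=
  W.not_hasRationalCM_of_ringHom_real (NumberField.InfinitePlace.embedding_of_isReal hw)

section NumberField

variable [NumberField K]

/-- **`End_K(E) = ℤ` over a totally real field**: no elliptic curve over a totally real number field
`K` has `K`-rational complex multiplication (a CM curve over `K` acquires its complex multiplication
only over the CM field, which is not real). Silverman, *Advanced Topics*, Thm. II.2.2(a).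
[cite: SilvermanAdvancedTopics1994, Thm. II.2.2(a)] -/
theorem not_hasRationalCM_of_isTotallyReal [NumberField.IsTotallyReal K] (W : WeierstrassCurve K)
    [W.IsElliptic] : ¬ W.HasRationalCM :=
  W.not_hasRationalCM_of_isReal
    (NumberField.IsTotallyReal.isReal (Classical.arbitrary (NumberField.InfinitePlace K)))

/-! ## Silverman, *AEC*, Cor. IX.6.3 over real number fields, unconditionally -/

/-- **Cor. IX.6.3 over a number field with a real embedding, unconditionally**: for every elliptic
curve `E = W` over a number field `K` admitting `K →+* ℝ`, the `Γ_K`-module `E[ℓ]` is irreducible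
for all but finitely many primes `ℓ` — the set of primes `ℓ` with a `Γ_K`-stable subgroup of `E[ℓ]`
other than `O`, `E[ℓ]` (`¬ W.HasIrreducibleModPGaloisRep ℓ`) is finite. From the tree's
`finite_setOf_not_hasIrreducibleModPGaloisRep` (Cor. IX.6.3 under `End_K(E) = ℤ`, via Shafarevich's
theorem) and `not_hasRationalCM_of_ringHom_real`; the "no complex multiplication" hypothesis of the
printed corollary is not needed over a real field. [cite: SilvermanAEC2009, Cor. IX.6.3] -/
theorem finite_setOf_not_hasIrreducibleModPGaloisRep_of_ringHom_real (φ : K →+* ℝ)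
    (W : WeierstrassCurve K) [W.IsElliptic] :
    {ℓ : ℕ | ℓ.Prime ∧ ¬ W.HasIrreducibleModPGaloisRep ℓ}.Finite :=
  W.finite_setOf_not_hasIrreducibleModPGaloisRep (W.not_hasRationalCM_of_ringHom_real φ)

/-- **Cor. IX.6.3 over a totally real field, unconditionally**: for every elliptic curve `E = W`
over a totally real number field `K` (CM or not), the set of primes `ℓ` for which `E[ℓ]` is a
reducible `Γ_K`-module is finite. [cite: SilvermanAEC2009, Cor. IX.6.3] -/
theorem finite_setOf_not_hasIrreducibleModPGaloisRep_of_isTotallyReal [NumberField.IsTotallyReal K]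
    (W : WeierstrassCurve K) [W.IsElliptic] :
    {ℓ : ℕ | ℓ.Prime ∧ ¬ W.HasIrreducibleModPGaloisRep ℓ}.Finite :=
  W.finite_setOf_not_hasIrreducibleModPGaloisRep (W.not_hasRationalCM_of_isTotallyReal)

/-- **Cofinite form of Cor. IX.6.3 over a totally real field**: for every elliptic curve `E/K`,
`K` totally real, there is `N` such that `E[p]` is an irreducible `Γ_K`-module for every prime
`p > N`. [cite: SilvermanAEC2009, Cor. IX.6.3] -/
theorem exists_forall_hasIrreducibleModPGaloisRep_of_lt_of_isTotallyReal
    [NumberField.IsTotallyReal K] (W : WeierstrassCurve K) [W.IsElliptic] :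
    ∃ N : ℕ, ∀ p : ℕ, N < p → p.Prime → W.HasIrreducibleModPGaloisRep p := by
  obtain ⟨N, hN⟩ := (W.finite_setOf_not_hasIrreducibleModPGaloisRep_of_isTotallyReal).bddAbove
  refine ⟨N, fun p hp hprime ↦ ?_⟩
  by_contra h
  exact absurd (hN ⟨hprime, h⟩) (not_le.mpr hp)

end NumberField

end WeierstrassCurve

end
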